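import Literature.AnabelianGeometry.AbsoluteAnabelian.HolomorphicCoresDeckProofs
import Literature.Geometry.Kaehler.RiemannSurfaceUniformization
import Literature.Geometry.Kaehler.RiemannSphereFixedPoint
import Literature.Analysis.Complex.InjectiveEntireAffine
import HarnessLib

/-!
# A simply connected holomorphic cover with non-abelian deck group is the disc (modulo uniformization)

Layer `Literature/AnabelianGeometry/AbsoluteAnabelian`, PROOF-ONLY (abc-iut cell, programme «UNIF-G1P»
Tier 2, GAP G-L4t8g7-2).  I-Hsiung Lin, *Classical Complex Analysis* vol. 2 (2011), §7.6.2, (7.6.2.1) and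
the discussion after it: a Riemann surface `R` is `R̃/G` with `R̃ ∈ {ℂ*, ℂ, 𝔻}` and `G ≅ π₁(R)` a group of
fixed-point-free conformal automorphisms; «The elliptic type `R̃ = ℂ*`: since the group `G(R̃, F̃) = {1}`
…» (every Möbius transformation has a fixed point); «If `R̃ = ℂ` … `Φ(z) = z + b`, a translation» (so `G` is
abelian).  Hence: **if the deck group is non-abelian, the universal covering is the disc.**  We prove this
consequence for any simply connected Riemann surface `U` holomorphically covering `X` with two
non-commuting deck transformations, CONDITIONAL on the named fact
`RiemannSurface.SimplyConnectedUniformization` (p447959) and using the tree's theorems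
`Literature.Analysis.Complex.comp_comm_of_forall_ne` (free biholomorphic actions on `ℂ` are abelian,
p445403) and `RiemannSphere.not_forall_ne_of_mdifferentiable` (every biholomorphism of `ℂ ∪ {∞}` has a
fixed point, p446472); deck transformations are holomorphic (`mdifferentiable_of_mem_deckGroup`) and the
non-trivial ones are fixed-point free (uniqueness of lifts, Mathlib `IsCoveringMap.eq_of_comp_eq`).

* `eq_refl_of_mem_deckGroup_of_apply_eq` — a deck transformation of a connected cover fixing a point is
  the identity;
* `not_nonempty_biholomorphic_complex_of_nonabelian_deckGroup` — such `U` is not biholomorphic to `ℂ`;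
* `not_nonempty_biholomorphic_riemannSphere_of_ne_refl` — nor to the Riemann sphere (as soon as one deck
  transformation is not the identity);
* `exists_disc_covering_of_nonabelian_deckGroup` — **modulo `SimplyConnectedUniformization`, `X` is
  holomorphically covered by the unit disc** (the [AbsTopIII] Cor. 2.4 / 2.7 universal-cover binder at the
  general hyperbolic Riemann surface, once its universal cover is known to have non-abelian deck group,
  e.g. compact genus `≥ 2`).

HONEST FRAMING: classical; conditional on one named fact (Tier 2 of the programme); nothing here bears on
the disputed [IUTchIII] Cor. 3.12.
-/

noncomputable section

open Set Function Metric TopologicalSpace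
open scoped Manifold ContDiff Topology

namespace Literature.AnabelianGeometry.AbsoluteAnabelian

variable {U X : Type} [TopologicalSpace U] [ChartedSpace ℂ U] [IsManifold 𝓘(ℂ, ℂ) ω U]
  [TopologicalSpace X] [ChartedSpace ℂ X] [IsManifold 𝓘(ℂ, ℂ) ω X] {u : U → X}

omit [ChartedSpace ℂ U] [IsManifold 𝓘(ℂ, ℂ) ω U] [ChartedSpace ℂ X] [IsManifold 𝓘(ℂ, ℂ) ω X] in
/-- **A deck transformation of a connected covering space that fixes a point is the identity** (uniqueness
of lifts; Lin (7.5.4.2) (2) «it cannot have any fixed point except the identity»).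
[cite: Lin2011ClassicalComplexAnalysisII, §7.6.2 (7.6.2.1)] -/
theorem eq_refl_of_mem_deckGroup_of_apply_eq [PreconnectedSpace U] (hu : IsCoveringMap u)
    {γ : U ≃ₜ U} (hγ : γ ∈ deckGroup u) {x : U} (hx : γ x = x) : γ = Homeomorph.refl U := by
  have hγu : ∀ y, u (γ y) = u y :=
    (Literature.Geometry.Kaehler.ComplexTorus.mem_deckTransformations_iff u γ).1 hγ
  have h := hu.eq_of_comp_eq γ.continuous continuous_id (funext fun y => hγu y) x hx
  ext y
  exact congrFun h y

/-- **A simply connected Riemann surface with two non-commuting holomorphic covering transformations over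
some base is not biholomorphic to `ℂ`** (on `ℂ` the transported deck transformations would be
fixed-point-free injective entire functions, which commute: `comp_comm_of_forall_ne`).
[cite: Lin2011ClassicalComplexAnalysisII, §7.6.2 (7.6.2.1)] -/
theorem not_nonempty_biholomorphic_complex_of_nonabelian_deckGroup [PreconnectedSpace U]
    (hu : IsCoveringMap u) (hud : MDifferentiable 𝓘(ℂ, ℂ) 𝓘(ℂ, ℂ) u)
    {γ δ : U ≃ₜ U} (hγ : γ ∈ deckGroup u) (hδ : δ ∈ deckGroup u) (hne : γ * δ ≠ δ * γ)
    (e : U ≃ₜ ℂ) (he : MDifferentiable 𝓘(ℂ, ℂ) 𝓘(ℂ, ℂ) e)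
    (hesymm : MDifferentiable 𝓘(ℂ, ℂ) 𝓘(ℂ, ℂ) e.symm) : False := by
  -- transported maps `ℂ → ℂ`
  let T : (U ≃ₜ U) → ℂ → ℂ := fun φ z => e (φ (e.symm z))
  have hT_diff : ∀ {φ : U ≃ₜ U}, φ ∈ deckGroup u → Differentiable ℂ (T φ) := by
    intro φ hφ
    have h1 : MDifferentiable 𝓘(ℂ, ℂ) 𝓘(ℂ, ℂ) (T φ) :=
      (he.comp (mdifferentiable_of_mem_deckGroup hu hud hφ)).comp hesymm
    exact fun z => mdifferentiableAt_iff_differentiableAt.1 (h1 z)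
  have hT_inj : ∀ φ : U ≃ₜ U, Injective (T φ) := fun φ =>
    e.injective.comp (φ.injective.comp e.symm.injective)
  have hT_fix : ∀ {φ : U ≃ₜ U}, φ ∈ deckGroup u → φ ≠ Homeomorph.refl U → ∀ z, T φ z ≠ z := by
    intro φ hφ hφ1 z hz
    apply hφ1
    refine eq_refl_of_mem_deckGroup_of_apply_eq hu hφ (x := e.symm z) ?_
    have : e (φ (e.symm z)) = e (e.symm z) := by rw [e.apply_symm_apply]; exact hz
    exact e.injective this
  -- if either is the identity they commute
  have hγ1 : γ ≠ Homeomorph.refl U := by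
    intro h; apply hne; rw [h]; rfl
  have hδ1 : δ ≠ Homeomorph.refl U := by
    intro h; apply hne; rw [h]; rfl
  have hcomm := Literature.Analysis.Complex.comp_comm_of_forall_ne (hT_diff hγ) (hT_inj γ)
    (hT_fix hγ hγ1) (hT_diff hδ) (hT_inj δ) (hT_fix hδ hδ1)
  apply hne
  ext y
  have h := congrFun hcomm (e y)
  simp only [Function.comp_apply, T, e.symm_apply_apply] at h
  have h' := e.injective h
  -- `γ (δ y) = δ (γ y)`
  change (γ * δ) y = (δ * γ) y
  rw [Homeomorph.mul_apply, Homeomorph.mul_apply]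
  exact h'

/-- **A simply connected Riemann surface with a non-trivial holomorphic covering transformation over some
base is not biholomorphic to the Riemann sphere** (the transported transformation would be a
fixed-point-free biholomorphism of `ℂ ∪ {∞}`: `RiemannSphere.not_forall_ne_of_mdifferentiable`).
[cite: Lin2011ClassicalComplexAnalysisII, §7.6.2 (7.6.2.1)] -/
theorem not_nonempty_biholomorphic_riemannSphere_of_ne_refl [PreconnectedSpace U]
    (hu : IsCoveringMap u) (hud : MDifferentiable 𝓘(ℂ, ℂ) 𝓘(ℂ, ℂ) u)
    {γ : U ≃ₜ U} (hγ : γ ∈ deckGroup u) (hγ1 : γ ≠ Homeomorph.refl U)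
    (e : U ≃ₜ OnePoint ℂ) (he : MDifferentiable 𝓘(ℂ, ℂ) 𝓘(ℂ, ℂ) e)
    (hesymm : MDifferentiable 𝓘(ℂ, ℂ) 𝓘(ℂ, ℂ) e.symm) : False := by
  let φ : OnePoint ℂ ≃ₜ OnePoint ℂ := e.symm.trans (γ.trans e)
  have hφ : MDifferentiable 𝓘(ℂ, ℂ) 𝓘(ℂ, ℂ) φ :=
    (he.comp (mdifferentiable_of_mem_deckGroup hu hud hγ)).comp hesymm
  refine Literature.Geometry.Kaehler.RiemannSphere.not_forall_ne_of_mdifferentiable φ hφ fun z hz => ?_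
  apply hγ1
  refine eq_refl_of_mem_deckGroup_of_apply_eq hu hγ (x := e.symm z) ?_
  have : e (γ (e.symm z)) = z := hz
  calc γ (e.symm z) = e.symm (e (γ (e.symm z))) := (e.symm_apply_apply _).symm
    _ = e.symm z := by rw [this]

/-- **Modulo the uniformization theorem for simply connected Riemann surfaces, a simply connected
holomorphic cover with non-abelian deck group is the disc**: if `u : U → X` is a surjective holomorphic
covering map from a simply connected (Hausdorff, second countable) Riemann surface with two non-commuting
deck transformations, then `X` has a surjective holomorphic covering by the open unit disc — the
universal-cover binder of [AbsTopIII] Cor. 2.4 at the general hyperbolic Riemann surface, CONDITIONAL on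
`RiemannSurface.SimplyConnectedUniformization`. [cite: Lin2011ClassicalComplexAnalysisII, §7.6.2 (7.6.2.1)] -/
theorem exists_disc_covering_of_nonabelian_deckGroup
    (H2 : Literature.Geometry.Kaehler.RiemannSurface.SimplyConnectedUniformization)
    [T2Space U] [SecondCountableTopology U] [SimplyConnectedSpace U]
    (hu : IsCoveringMap u) (hsurj : Function.Surjective u) (hud : MDifferentiable 𝓘(ℂ, ℂ) 𝓘(ℂ, ℂ) u)
    (hna : ∃ γ ∈ deckGroup u, ∃ δ ∈ deckGroup u, γ * δ ≠ δ * γ) :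
    ∃ p : unitDiscOpens → X,
      IsCoveringMap p ∧ Function.Surjective p ∧ MDifferentiable 𝓘(ℂ, ℂ) 𝓘(ℂ, ℂ) p := by
  obtain ⟨γ, hγ, δ, hδ, hne⟩ := hna
  rcases H2 U with ⟨e, he, hesymm⟩ | ⟨e, he, hesymm⟩ | ⟨e, he, hesymm⟩
  · -- the disc: compose
    refine ⟨u ∘ e.symm, hu.comp_homeomorph e.symm, hsurj.comp e.symm.surjective, ?_⟩
    exact hud.comp hesymm
  · exact (not_nonempty_biholomorphic_complex_of_nonabelian_deckGroup hu hud hγ hδ hne e he hesymm).elim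
  · have hγ1 : γ ≠ Homeomorph.refl U := by
      intro h; apply hne; rw [h]; rfl
    exact (not_nonempty_biholomorphic_riemannSphere_of_ne_refl hu hud hγ hγ1 e he hesymm).elim

end Literature.AnabelianGeometry.AbsoluteAnabelian

end
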